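import Summits.Ventures.GridStability.Lyapunov.WSCC9SP9SlabOData

/-!
# GridStability/Bench/WSCC9SP9SlabORoa — «G2.b-SP9-SLAB-O»: the RATE-OPTIMISED slab certificate on ★ #45's object (lineage O),
# kernel-checked, and its certified region (companion of Bench/WSCC9SP9SlabORate)

Cell `gridfusion` (LADDER-GRIDFUSION), SP–Lur'e lane; seat gridfusion-model-2 (g7); follow-up of #94-cand «G2.b-SP9-SLAB-RATE» (RULING
7d «SUFFICIENT, NOT SHARP»): the same MODEL and CLASS as ★ #45 with the certificate re-solved for the best certified decay quantity
(STATUS RUN 13:46:04Z, kit j280194). NOT OF RECORD unless the lead books it. OBJECT: `WSCC9SP.relLurie D` with ★ #45's `D`, `hD`,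
`AQ`, `BQ`, `CQ`, `A_eq`, `B_eq`, `C_eq`, `e1`, `e2` REUSED BY NAME from `Bench/WSCC9SP9SlabRoa` p504776 — nothing object-level is
restated; only the certificate data (`POq`, `epsOQ = 47/524288`, `etaOQ = 1/50`, `tauOQ`, `lamOQ`, `cOQ`) is new
(`Lyapunov/WSCC9SP9SlabOData`). WHAT IS PROVED: (1) the slab blocks over `ℚ` from ★ #45's system matrices and the O data EQUAL the
decided `M2Oq` (`slabOQ_eq`, one kernel `decide`); (2) `certO : SlabCertificate (WSCC9SP.relLurie D)` from the integer Gram certificates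
[cite: Pai1981, §2.16 Theorem [18] eqs. (2.63)–(2.64)]; (3) `sp9O_slab_roa` = `WSCC9SP.slab_roa_of_eps` (p500745) with `u = 1/4`,
`γ_lo = 97/200`, `c = cOQ = 442223/41943040000`. THREE COLUMNS. CERTIFIED: (2)–(3) for MODEL M′_D, CLASS slab `u = 1/4`, ε-level `cOQ`.
MODELLED: ★ #45 verbatim. VALIDATED: the SDP sweep and the region datum. Nothing here says the WSCC system or any grid is stable.
-/



noncomputable section

open Set Filter Topology Real Matrix
open Literature.MathematicalPhysics.PowerSystems
open Literature.MathematicalPhysics.PowerSystems.LyapunovFunctionFamily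
open Literature.Computation.Certificates
open Summit.Ventures.GridStability.Models
open Summit.Ventures.GridStability.Models.StructurePreserving
open Summit.Ventures.GridStability.Models.WSCC9SP
open Summit.Ventures.GridStability.Lyapunov.WSCC9SP9Slab (aQ)
open Summit.Ventures.GridStability.Lyapunov.WSCC9SP9SlabO
open Summit.Ventures.GridStability.Bench.WSCC9SP9Slab (D hD e1 e2 edgeIncQ AQ BQ CQ edgeInc_eq A_eq B_eq C_eq)

namespace Summit.Ventures.GridStability.Bench.WSCC9SP9SlabO

/-! ### The slab blocks over `ℚ` and the decided identity with `M2Oq` -/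

/-- `P` of lineage O over `ℚ`, reindexed to the state type. -/
def POQ : Matrix (Fin 8 ⊕ Fin 3) (Fin 8 ⊕ Fin 3) ℚ := POq.submatrix e1 e1

/-- `τ_e·a_e·b_e` with `a_e = 7/10`, `b_e = 1`. -/
def tabOQ : Fin 8 → ℚ := fun e => tauOQ e * (aQ * 1)

/-- `τ_e·(a_e + b_e)/2`. -/
def tab2OQ : Fin 8 → ℚ := fun e => tauOQ e * (aQ + 1) / 2

/-- State block over `ℚ`: `AᵀP + PA + η·1 − Cᵀ·diag(τab)·C`. -/
def L11OQ : Matrix (Fin 8 ⊕ Fin 3) (Fin 8 ⊕ Fin 3) ℚ :=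
  AQᵀ * POQ + POQ * AQ + etaOQ • (1 : Matrix (Fin 8 ⊕ Fin 3) (Fin 8 ⊕ Fin 3) ℚ)
    - CQᵀ * Matrix.diagonal tabOQ * CQ

/-- Cross block over `ℚ`: `−PB + (CA)ᵀ·diag(λ) + Cᵀ·diag(τ(a+b)/2)`. -/
def L12OQ : Matrix (Fin 8 ⊕ Fin 3) (Fin 8) ℚ :=
  -(POQ * BQ) + (CQ * AQ)ᵀ * Matrix.diagonal lamOQ + CQᵀ * Matrix.diagonal tab2OQ

/-- Channel block over `ℚ`: `−diag(λ)·CB − (diag(λ)·CB)ᵀ − diag τ`. -/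
def L22OQ : Matrix (Fin 8) (Fin 8) ℚ :=
  -(Matrix.diagonal lamOQ * (CQ * BQ)) - (Matrix.diagonal lamOQ * (CQ * BQ))ᵀ - Matrix.diagonal tauOQ

set_option maxHeartbeats 400000 in
/-- **The exact certificate matrix**: `−𝓛 = M2Oq` (reindexed), decided in the kernel over `ℚ`. -/
theorem slabOQ_eq : -(Matrix.fromBlocks L11OQ L12OQ L12OQᵀ L22OQ) = M2Oq.submatrix e2 e2 := by
  decide +kernel

/-- `POQ` is symmetric (kernel). -/
theorem POQ_transpose : POQᵀ = POQ := by
  decide +kernel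

/-! ### The certificate data over `ℝ` -/

/-- `P` of lineage O (real). -/
def PO : Matrix (Fin 8 ⊕ Fin 3) (Fin 8 ⊕ Fin 3) ℝ := POQ.map (Rat.cast : ℚ → ℝ)
/-- `τ` of lineage O (real). -/
def τO : Fin 8 → ℝ := fun e => (tauOQ e : ℝ)
/-- `λ` of lineage O (real, Popov coefficients). -/
def lamO : Fin 8 → ℝ := fun e => (lamOQ e : ℝ)
/-- lower slopes `a_e = 7/10`. -/
def aO : Fin 8 → ℝ := fun _ => (aQ : ℝ)
/-- upper slopes `b_e = 1`. -/
def bO : Fin 8 → ℝ := fun _ => 1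

/-! ### Cast plumbing -/

/-- `(M·N) ↦ ℝ` = product of the casts (plumbing). -/
private theorem map_mul' {m n o : Type*} [Fintype n] (M : Matrix m n ℚ) (N : Matrix n o ℚ) :
    (M * N).map (Rat.cast : ℚ → ℝ) = M.map (Rat.cast : ℚ → ℝ) * N.map (Rat.cast : ℚ → ℝ) :=
  Matrix.map_mul (f := Rat.castHom ℝ)

/-- `(M+N) ↦ ℝ` = sum of the casts (plumbing). -/
private theorem map_add' {m n : Type*} (M N : Matrix m n ℚ) :
    (M + N).map (Rat.cast : ℚ → ℝ) = M.map (Rat.cast : ℚ → ℝ) + N.map (Rat.cast : ℚ → ℝ) := by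
  ext i j; simp

/-- `(M−N) ↦ ℝ` = difference of the casts (plumbing). -/
private theorem map_sub' {m n : Type*} (M N : Matrix m n ℚ) :
    (M - N).map (Rat.cast : ℚ → ℝ) = M.map (Rat.cast : ℚ → ℝ) - N.map (Rat.cast : ℚ → ℝ) := by
  ext i j; simp

/-- `(−M) ↦ ℝ` = minus the cast (plumbing). -/
private theorem map_neg' {m n : Type*} (M : Matrix m n ℚ) :
    (-M).map (Rat.cast : ℚ → ℝ) = -M.map (Rat.cast : ℚ → ℝ) := by
  ext i j; simp

/-- transpose commutes with the cast (plumbing, `rfl`). -/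
private theorem map_transpose' {m n : Type*} (M : Matrix m n ℚ) :
    Mᵀ.map (Rat.cast : ℚ → ℝ) = (M.map (Rat.cast : ℚ → ℝ))ᵀ := rfl

/-- `diag(d) ↦ ℝ = diag(d ↦ ℝ)` (plumbing). -/
private theorem map_diagonal' {n : Type*} [DecidableEq n] (d : n → ℚ) :
    (Matrix.diagonal d).map (Rat.cast : ℚ → ℝ) = Matrix.diagonal (fun i => (d i : ℝ)) :=
  Matrix.diagonal_map Rat.cast_zero

/-- `(q·1) ↦ ℝ = (q ↦ ℝ)·1` (plumbing). -/
private theorem map_smul_one' {n : Type*} [DecidableEq n] (q : ℚ) :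
    (q • (1 : Matrix n n ℚ)).map (Rat.cast : ℚ → ℝ) = (q : ℝ) • (1 : Matrix n n ℝ) := by
  ext i j
  by_cases h : i = j
  · subst h; simp
  · simp [h]

/-! ### The blocks of the certificate matrix over `ℝ` are the casts -/

/-- State block. -/
theorem L11O_eq : slabL11 (WSCC9SP.relLurie D) PO (etaOQ : ℝ) τO aO bO = L11OQ.map (Rat.cast : ℚ → ℝ) := by
  have hd : Matrix.diagonal (fun k => τO k * (aO k * bO k)) = (Matrix.diagonal tabOQ).map (Rat.cast : ℚ → ℝ) := by
    rw [map_diagonal']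
    congr 1; funext k; simp [τO, aO, bO, tabOQ]
  rw [slabL11, A_eq, C_eq, hd, PO, L11OQ]
  simp only [map_sub', map_add', map_mul', map_transpose', map_smul_one']

/-- Cross block. -/
theorem L12O_eq : slabL12 (WSCC9SP.relLurie D) PO lamO τO aO bO = L12OQ.map (Rat.cast : ℚ → ℝ) := by
  have hd1 : Matrix.diagonal lamO = (Matrix.diagonal lamOQ).map (Rat.cast : ℚ → ℝ) := by
    rw [map_diagonal']; rfl
  have hd2 : Matrix.diagonal (fun k => τO k * (aO k + bO k) / 2)
      = (Matrix.diagonal tab2OQ).map (Rat.cast : ℚ → ℝ) := by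
    rw [map_diagonal']
    congr 1; funext k; simp [τO, aO, bO, tab2OQ]
  rw [slabL12, A_eq, B_eq, C_eq, hd1, hd2, PO, L12OQ]
  simp only [map_add', map_neg', map_mul', map_transpose']

/-- Channel block. -/
theorem L22O_eq : slabL22 (WSCC9SP.relLurie D) lamO τO = L22OQ.map (Rat.cast : ℚ → ℝ) := by
  have hd1 : Matrix.diagonal lamO = (Matrix.diagonal lamOQ).map (Rat.cast : ℚ → ℝ) := by
    rw [map_diagonal']; rfl
  have hd3 : Matrix.diagonal τO = (Matrix.diagonal tauOQ).map (Rat.cast : ℚ → ℝ) := by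
    rw [map_diagonal']; rfl
  rw [slabL22, B_eq, C_eq, hd1, hd3, L22OQ]
  simp only [map_sub', map_neg', map_mul', map_transpose']

/-- **`−𝓛` over `ℝ` is the reindexed cast of `M2Oq`.** -/
theorem negO_slabMatrix_eq : -(slabMatrix (WSCC9SP.relLurie D) PO (etaOQ : ℝ) lamO τO aO bO)
    = (M2Oq.map (Rat.cast : ℚ → ℝ)).submatrix e2 e2 := by
  rw [slabMatrix, L11O_eq, L12O_eq, L22O_eq, ← map_transpose', ← Matrix.fromBlocks_map, ← map_neg',
    slabOQ_eq]
  rfl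

/-- `P − ε·1` over `ℝ` is the reindexed cast of `POq − epsOQ·1`. -/
theorem PO_sub_eq : PO - (epsOQ : ℝ) • (1 : Matrix (Fin 8 ⊕ Fin 3) (Fin 8 ⊕ Fin 3) ℝ)
    = ((POq - epsOQ • (1 : Matrix (Fin 11) (Fin 11) ℚ)).map (Rat.cast : ℚ → ℝ)).submatrix e1 e1 := by
  ext i j
  by_cases h : i = j
  · subst h; simp [PO, POQ]
  · have h' : e1 i ≠ e1 j := fun he => h (e1.injective he)
    simp [PO, POQ, h, h']

/-! ### The certificate -/

/-- **THE RATE-OPTIMISED SLAB CERTIFICATE (lineage O)** for `WSCC9SP.relLurie D` — ★ #45's OBJECT and CLASS, a different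
certificate: lit-6's `SlabCertificate` with the exact data of `WSCC9SP9SlabOData` (`P` dyadic 2⁻²⁰, `ε = 47/524288`, `η = 1/50`, `τ`,
`λ ≤ 10`, `a = 7/10`, `b = 1`); the two matrix facts come from the kernel-decided integer Gram certificates. NOT OF RECORD unless the
lead says so. [cite: Pai1981, §2.16 Theorem [18] eqs. (2.63)–(2.64); VuTuritsyn2017, §4.2 Lemma 1] -/
def certO : SlabCertificate (WSCC9SP.relLurie D) where
  P := PO
  ε := (epsOQ : ℝ)
  η := (etaOQ : ℝ)
  τ := τO
  lam := lamO
  a := aO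
  b := bO
  P_symm := by
    show (POQ.map (Rat.cast : ℚ → ℝ))ᵀ = POQ.map (Rat.cast : ℚ → ℝ)
    rw [← map_transpose', POQ_transpose]
  ε_pos := by exact_mod_cast scalarsO.2.1
  η_pos := by exact_mod_cast scalarsO.2.2.1
  P_ge := by
    rw [PO_sub_eq]
    exact (Matrix.posSemidef_submatrix_equiv e1).2 posSemidefO.1
  τ_nonneg := fun e => by unfold τO; exact_mod_cast (multO_nonneg e).1
  lam_nonneg := fun e => by unfold lamO; exact_mod_cast (multO_nonneg e).2
  a_nonneg_of_lam_pos := fun e _ => by unfold aO aQ; norm_num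
  lmi := by
    rw [negO_slabMatrix_eq]
    exact (Matrix.posSemidef_submatrix_equiv e2).2 posSemidefO.2.1

/-- `a_e = 7/10 ≤ slabSlope(1/4)` (= cos(θ + γ) ≈ 0.70266 exactly rational). -/
theorem aO_le_slabSlope : ∀ e, certO.a e ≤ (slabSlope (1 / 4) : ℝ) := fun e => by
  show ((aQ : ℚ) : ℝ) ≤ ((slabSlope (1 / 4) : ℚ) : ℝ)
  exact_mod_cast (show aQ ≤ slabSlope (1 / 4) by norm_num [aQ, slabSlope, tauV1])

/-- `1 ≤ b_e`. -/
theorem oneO_le_b : ∀ e, (1 : ℝ) ≤ certO.b e := fun _ => le_refl _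

/-- The level passes the ε-test: `2·c ≤ ε·γ_lo²`. -/
theorem hcO : 2 * ((cOQ : ℚ) : ℝ) ≤ certO.ε * (((97 / 200 : ℚ)) : ℝ) ^ 2 := by
  show 2 * ((cOQ : ℚ) : ℝ) ≤ ((epsOQ : ℚ) : ℝ) * (((97 / 200 : ℚ)) : ℝ) ^ 2
  exact_mod_cast scalarsO.1

/-! ### The canary sentence -/

/-- **«G2.b-SP9-SLAB-O» (lineage O: the RATE-OPTIMISED certificate on ★ #45's object and class; not of record unless the lead
says so) — the region sentence that goes with the rate certificate.** For every phase point `y = (δ, ω)` of MODEL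
M′_D = `(WSCC9SP.params D).phaseField` (★ #45's `D`) whose 8 listed line-angle deviations satisfy `|σ_e − σ*_e| ≤ 97/200` and whose
relative state has `V_O(relState y) ≤ cOQ = 442223/41943040000` (`V_O` = the slab Lyapunov function of `certO`): a solution from `y`
exists and EVERY solution keeps `|σ_e(t) − σ*_e| < 2·atan(1/4)` and `V_O ≤ cOQ` for all `t ≥ 0`, every bus-angle difference tends to
the equilibrium's, every machine frequency deviation tends to `0`. CERTIFIED for MODEL M′_D, CLASS = slab `u = 1/4`, `γ_lo = 97/200`,
ε-level `cOQ` (SMALLER than ★ #45's `cQ`: the rate-optimal certificate trades region for rate); MODELLED = ★ #45 VERBATIM «MV-3 +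
lossless + MV-RD(0.046 @ slack G1) + D⟨declared: MV-SPD transplant machines, buses 1/10 synthetic⟩ + V-frozen(V1) + ω_R = 377 printed +
ref bus 9; a structure-preserving VARIANT of the printed 9-bus, not a 9-bus sentence»; VALIDATED: the SDP sweep (kit j280194).
Nothing here says the WSCC system is stable. [cite: Pai1981, §2.16 Theorem [18] and §4.6–§4.7; VuTuritsyn2017, §4.3 Theorem 1] -/
theorem sp9O_slab_roa {y : (Fin 9 → ℝ) × (Fin 9 → ℝ)}
    (hy : ∀ e, |(y.1 (srcV e) - y.1 (tgtV e)) - (δ₀ (srcV e) - δ₀ (tgtV e))| ≤ ((97 / 200 : ℚ) : ℝ))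
    (hyc : certO.V (relState ref gnode δ₀ y) ≤ ((cOQ : ℚ) : ℝ)) :
    (∃ X : ℝ → (Fin 9 → ℝ) × (Fin 9 → ℝ), X 0 = y ∧
        ∀ T : ℝ, ∀ t ∈ Icc 0 T, HasDerivWithinAt X ((WSCC9SP.params D).phaseField (X t)) (Icc 0 T) t) ∧
      ∀ X : ℝ → (Fin 9 → ℝ) × (Fin 9 → ℝ), X 0 = y →
        (∀ T : ℝ, ∀ t ∈ Icc 0 T, HasDerivWithinAt X ((WSCC9SP.params D).phaseField (X t)) (Icc 0 T) t) →
        (∀ t, 0 ≤ t →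
            (∀ e, |((X t).1 (srcV e) - (X t).1 (tgtV e)) - (δ₀ (srcV e) - δ₀ (tgtV e))|
              < 2 * Real.arctan ((1 / 4 : ℚ) : ℝ)) ∧
            certO.V (relState ref gnode δ₀ (X t)) ≤ ((cOQ : ℚ) : ℝ)) ∧
          (∀ v w, Tendsto (fun t => (X t).1 v - (X t).1 w) atTop (𝓝 (δ₀ v - δ₀ w))) ∧
          ∀ v ∈ genS, Tendsto (fun t => (X t).2 v) atTop (𝓝 0) :=
  WSCC9SP.slab_roa_of_eps hD certO (u := 1 / 4) (γlo := 97 / 200) (by norm_num) (by norm_num)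
    (by norm_num) (by norm_num) aO_le_slabSlope oneO_le_b hcO hy hyc

end Summit.Ventures.GridStability.Bench.WSCC9SP9SlabO

end
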